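import Summits.BirchSwinnertonDyer.BirchSwinnertonDyer.Theorems.KatoDescentPotSupersingularKatoFiniteLevelStrictSha
import Summits.BirchSwinnertonDyer.Rank1Residual.Additive.UnramifiedKummerDisjoint
import HarnessLib

/-!
# Kato's (14.9.3) at finite level, part 13: the order of the §14.8 summand — `#H¹_ur(F, A) = #A^{Γ_F}` as soon as the
# INERTIA INVARIANTS `A^{I_F}` are finite (Milne *ADT* I Lemma 2.9 for infinite `A`), and `#H¹_ur(K_v, E[p^∞]) = #H⁰(K_v, E[p^∞])`
# (route `KatoDescentPotSupersingular` / `…Tame…`, crux M = stmt-BirchSwinnertonDyer-19196; route-free helper)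

Seat `bsd-potss-rkm` g17 (prover; cell `bsd-potss`), item stmt-BirchSwinnertonDyer-19196 (`--supports … --as helper`; closes
nothing).  HONEST FRAMING: BSD is not proved by any of this; nothing is booked; theorems only (no definition, no named fact).

Kato §14.8 (p. 238): the summand at a finite place `v ∤ p` of the embedding `S(T)/Sel(T) ↪ ⊕_v …` is
`H¹(𝔽_v, H⁰(K_v^{ur}, T⊗ℚ/ℤ))` — for `T = T_pE`, `H¹(𝔽_v, E[p^∞]^{I_v}) = H¹_ur(K_v, E[p^∞])`, the factor of part 11's bound
`#Sel_str^{ur} ≤ #Sel_{p^∞}(E/K) · ∏_{v∈T∖P} #H¹_ur(K_v, E[p^∞])`.  Its order: for a FINITE `Ẑ`-module `N`, `h¹ = h⁰`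
(`#N/(F−1)N = #N^{F=1}`); the tree's `Additive.natCard_unramifiedSubgroup_eq_natCard_invariants_general` states this for finite
`A`; the same proof (inflation `H¹(Γ_F/I_F, A^{I_F}) ⥲ H¹_ur(F, A)`, tree `natCard_continuousCohomology_one_quotient_galUnr`,
`invariantsQuotientInvariantsEquiv`) needs only **`A^{I_F}` finite** — the case of `A = E[p^∞]` at a place of additive,
potentially good reduction (`V_pE^{I_v} = 0`), where `A` itself is infinite.

* **`natCard_unramifiedSubgroup_eq_natCard_invariants_of_finite_inertiaInvariants`** — `#H¹_ur(F, A) = #A^{Γ_F}` for every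
  discrete `Γ_F`-module `A` with `A^{I_F}` finite.
* **`natCard_unramifiedSubgroup_primary_eq_natCard_invariants`** — `#H¹_ur(K_v, E[p^∞]) = #H⁰(K_v, E[p^∞])` whenever the
  `I_v`-fixed points of `E[p^∞]` form a finite set.

References: J. S. Milne, *ADT* I Lemma 2.9 [MilneADT2006]; K. Rubin, *Euler Systems* Prop. 1.4.13 (1); K. Kato, Astérisque 295 (2004)
§14.8 [Kato2004Asterisque].
-/

-- the summit and its single problem are both named `BirchSwinnertonDyer` (registry layout D-0017)
set_option linter.dupNamespace false
set_option autoImplicit false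

noncomputable section

open scoped Classical ContRepresentation NumberField
open Function Field NumberField IsDedekindDomain WeierstrassCurve
open Literature.NumberTheory.EllipticCurves Literature.NumberTheory.GaloisRepresentations
  Literature.NumberTheory.GaloisRepresentations.DiscreteGaloisModule Literature.NumberTheory.GaloisCohomology
open Summit.BirchSwinnertonDyer.Rank1Residual.X11b.LocBridge
open Summit.BirchSwinnertonDyer.Rank1Residual.Additive

universe u

namespace Summit.BirchSwinnertonDyer.BirchSwinnertonDyer.Theorems.KatoFiniteLevelCount

/-! ## §1 `#H¹_ur(F, A) = #A^{Γ_F}` when `A^{I_F}` is finite -/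

section General

variable {F : Type u} [Field F] [ValuativeRel F] [TopologicalSpace F] [IsNonarchimedeanLocalField F]
  {A : Type u} [AddCommGroup A] [TopologicalSpace A] [DiscreteTopology A] (ρ : DiscreteGaloisModule F A)

/-- **`#H¹_ur(F, A) = #A^{Γ_F}` for every discrete module `A` whose inertia invariants `A^{I_F}` are FINITE** (Milne *ADT* I
Lemma 2.9 / Rubin Prop. 1.4.13 (1) as a count; `A` itself may be infinite, e.g. `E[p^∞]` at a place of additive potentially good
reduction): `H¹_ur` is the image of the injective inflation from `Γ_F/I_F` (tree `mem_unramifiedSubgroup_one_iff_mem_range_infOne`)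
and `h¹ = h⁰` for the finite `Γ_F/I_F ≅ Ẑ`-module `A^{I_F}` (tree `natCard_continuousCohomology_one_quotient_galUnr`).  Proof
verbatim that of the tree's `Additive.natCard_unramifiedSubgroup_eq_natCard_invariants_general` (stated there for finite `A`).
[cite: MilneADT2006, Ch. I, Lemma 2.9] [cite: Rubin2011, Prop. 1.4.13 (1) (p. 9)] -/
theorem natCard_unramifiedSubgroup_eq_natCard_invariants_of_finite_inertiaInvariants
    [Finite (Representation.invariants (ρ.toRepresentation.comp (galUnr F).subtype))] :
    Nat.card (DiscreteGaloisModule.unramifiedSubgroup ρ 1) = Nat.card ρ.toTopRep.ρ.invariants := by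
  haveI := absoluteGaloisGroup_compactSpace F
  set N : Subgroup (absoluteGaloisGroup F) := galUnr F
  have e : continuousCohomology 1 (ρ.quotientInvariants N).toTopRep ≃
      DiscreteGaloisModule.unramifiedSubgroup ρ 1 :=
    Equiv.ofBijective
      (fun x ↦ ⟨infOne N ρ x, (mem_unramifiedSubgroup_one_iff_mem_range_infOne ρ _).mpr ⟨x, rfl⟩⟩)
      ⟨fun x y hxy ↦ infOne_injective N ρ (congrArg Subtype.val hxy),
        fun c ↦ by
          obtain ⟨x, hx⟩ := (mem_unramifiedSubgroup_one_iff_mem_range_infOne ρ c.1).mp c.2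
          exact ⟨x, Subtype.ext hx⟩⟩
  rw [← Nat.card_congr e, natCard_continuousCohomology_one_quotient_galUnr F _ (ρ.quotientInvariants N)]
  exact Nat.card_congr (invariantsQuotientInvariantsEquiv N ρ)

/-- The finiteness hypothesis from a finite set of `I_F`-fixed points. [folklore] -/
theorem finite_inertiaInvariants_of_finite_setOf
    (hfin : Set.Finite {a : A | ∀ τ ∈ absInertia F, ρ τ a = a}) :
    Finite (Representation.invariants (ρ.toRepresentation.comp (galUnr F).subtype)) := by
  refine (hfin.subset fun a ha => ?_).to_subtype
  intro τ hτ
  have hτ' : τ ∈ galUnr F := by rw [galUnr_eq_absInertia F]; exact hτ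
  exact (Representation.mem_invariants _ _).mp ha ⟨τ, hτ'⟩

end General

/-! ## §2 `#H¹_ur(K_v, E[p^∞]) = #H⁰(K_v, E[p^∞])` -/

section Primary

variable {K : Type} [Field K] [NumberField K] (W : WeierstrassCurve K) (p : ℕ)

/-- **`#H¹_ur(K_v, E[p^∞]) = #H⁰(K_v, E[p^∞])` whenever the `I_v`-fixed points of `E[p^∞]` form a finite set** (e.g. at a
place `v ∤ p` of additive, potentially good reduction, where `V_pE^{I_v} = 0`) — the order of Kato's §14.8 summand
`H¹(𝔽_v, E[p^∞]^{I_v})`. [cite: Kato2004Asterisque, §14.8 (p. 238)] [cite: MilneADT2006, Ch. I, Lemma 2.9] -/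
theorem natCard_unramifiedSubgroup_primary_eq_natCard_invariants (v : HeightOneSpectrum (𝓞 K))
    (hfin : Set.Finite {x : W.geomPrimaryTorsion p |
      ∀ τ ∈ absInertia (v.adicCompletion K), GaloisRep.toLocal v (primaryGaloisModule W p) τ x = x}) :
    Nat.card (unramifiedSubgroup (GaloisRep.toLocal v (primaryGaloisModule W p)) 1) =
      Nat.card (GaloisRep.toLocal v (primaryGaloisModule W p)).toTopRep.ρ.invariants := by
  haveI := finite_inertiaInvariants_of_finite_setOf (GaloisRep.toLocal v (primaryGaloisModule W p)) hfin
  exact natCard_unramifiedSubgroup_eq_natCard_invariants_of_finite_inertiaInvariants _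

end Primary

end Summit.BirchSwinnertonDyer.BirchSwinnertonDyer.Theorems.KatoFiniteLevelCount

end
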